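/-
Copyright (c) 2026 the pub-hodgecm-mathlib formalisation cell (harness21).  Prover seat hodgecm-mathlib-R90-C10-p04 (g3), SLAB R90-TF, section S1 «Ch. 10∕12 local»,
cell «U4-RAM :182 B_pos (ramified tame)», card (6a-G)(β) (dealer R90-C10-plan (g3) 02:24:16Z, R-S1-28 (3), R-S1-29 (β)): THE GAUSS-SPHERE VALUES, FILE 1 «NORM-CLASS CONSTANCY
OF THE LEVEL-ONE SPHERE FIBRE ALONG THE BASE FAMILY», crux H413 = `stmt-HodgeConjecture-24833`.  KERNEL module: THEOREMS ONLY (no definition, no named fact, no `sorry`, no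
instance, no notation).  2026-09-05.
-/
import Summits.HodgeConjecture.HodgeConjecture.Theorems.R90S1BposRamGaussSphereCovariance   -- ★ p864588 (R90-C10-p08 (g2)): (G1) COVARIANCE `Φ(e·a) = χ₁(e)⁻¹·Φ(a)`
import Summits.HodgeConjecture.HodgeConjecture.Theorems.R90S1BposRamShellFibresOdd         -- ★ p864416 (R90-C10-p07 (g2)): the base family `lᵗ·(−(x·σx)·c)` letters
import HarnessLib

/-!
# R90 · S1 ∕ U4Keys leaf (U4f-χ₁-ram-one-pos), BRANCH B, TAME RAMIFIED — (6a-G)(β) FILE 1: NORM-CLASS CONSTANCY OF `Φ` ALONG THE BASE FAMILY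
# `Φ(N(y)·a) = Φ(a)` for every unit `y` with `|y|_w = 1` (Branch B), hence `Φ(lᵗ¹·a(x₁)) = Φ(lᵗ²·a(x₂))` for any two members of the base family of EQUAL non-zero level   [Keys1984 §7 Thm (2)]

Cell `pub/hodgecm-mathlib` (D-0151), SLAB R90-TF, section S1 «Ch. 10∕12 local», crux H413 = `stmt-HodgeConjecture-24833` (lane `--supports … --as helper`), route of record
`HCCMUnconditional` (no route verbs); prover seat `hodgecm-mathlib-R90-C10-p04` (g3), card (6a-G)(β) `R90S1BposRamGaussSphereValues` (HEADS 02:29Z (T2)).  THEOREMS ONLY; ★-only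
imports (no `Lines` import).  NOT THE PAYER of :182 ∕ (S-RT).

FRAME (★ p864588 ∕ ★ p864416): `R := LocalRing L v = ∏_{w′ ∣ v} L_{w′}` (one place `w`, `σ•w = w`), `σ := conjLocal`, `R⁻ = skewPart σ`, `μY` a measure on `R⁻`,
`Ē r := χ₁(r̂)⁻¹` (`0` off units), `S₁ := {s ∈ R⁻ : |s_w| = exp(−1)}`, **`Φ(a) := ∫_{S₁} Ē(a − s) dμY(s)`** (the level-one sphere fibre of (6a) PART 3 ∕ p07 (6e)'s letters).
LETTERS: `hB` = the Branch-B hypothesis «`χ₁(u·σu) = 1` for every unit `u` with `|u_{w′}| = 1`» (★ p863838 bytes); the ONE-CURRENCY scaling unit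
`l := Units.map σ piU * piU` (`piU ∈ Rˣ`; NO valuation hypothesis on `piU` is needed here); base family `a′(t, x) := lᵗ · (−(x·σx)·c)` (p07 (6e) bytes, any `c ∈ R`).
RESULTS.
* §1 **`setIntegral_sphere_diteInv_sub_norm_mul`** — `Φ(↑(y·σy) · a) = Φ(a)` for every unit `y` with `|y_{w′}| = 1` and EVERY `a` (★ p864588 with `e := y·σy`, then `hB`).
* §2 **`setIntegral_sphere_diteInv_sub_family_eq`** — for two members `a′₁ = a′(t₁,x₁)`, `a′₂ = a′(t₂,x₂)` with `|a′₁|_w = |a′₂|_w ≠ 0`: **`Φ(a′₁) = Φ(a′₂)`** — the quotient is the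
  NORM `N(y)`, `y := piU^t₁·x̂₁·(piU^t₂·x̂₂)⁻¹`, `|N y|_w = 1 ⇒ |y|_w = 1`.  This is the (G1)-as-letter input of p07 (6e)'s `hΦcrit` ∕ p03 (6d-R)'s `hΦcritC`: on the critical level
  `Φ` is constant ALONG THE FAMILY (not on all `σ`-fixed `a` of that level — `Φ(e·a) = χ₁(e)⁻¹Φ(a)` and `χ₁|_{𝒪_F^×} ≠ 1` in (R-b)).
HONEST LABEL.  HC_CM is proved only modulo the 7 printed citations (2 remaining named inputs: hLiu418 = `stmt-HodgeConjecture-24832`, h413 = `stmt-HodgeConjecture-24833`) until rung 0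
closes; count-neutral — this file pays NO socket (:182, (S-RT), A2′ stay OPEN); no printed citation is discharged; REL ≠ ★ ≠ BUILT.

## References
* [Keys1984] D. Keys, *Principal series representations of special unitary groups over local fields*, Compositio Math. 51 (1984), §4–§5, §7 Theorem (2) (d) p. 126.
* [Rogawski1990] J. D. Rogawski, *Automorphic Representations of Unitary Groups in Three Variables*, Ann. of Math. Stud. 123 (1990), §12.2 (2) p. 173.
* [WeilBNT1967] A. Weil, *Basic Number Theory* (1967), Ch. I §2, Ch. II §5.
-/

set_option autoImplicit false
-- the mandated namespace has the single-problem summit's repeated segment (`HodgeConjecture.HodgeConjecture`)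
set_option linter.dupNamespace false

noncomputable section

open NumberField IsDedekindDomain MeasureTheory Measure Topology Set
open scoped NNReal ENNReal
open Literature.NumberTheory Literature.NumberTheory.Automorphic Literature.NumberTheory.Automorphic.UnitaryGroup

namespace Summit.HodgeConjecture.HodgeConjecture.R90.S1.BposRamGaussSphereFamily

open Summit.HodgeConjecture.HodgeConjecture.Cruxes.H413
open Summit.HodgeConjecture.HodgeConjecture.Cruxes.H413.K2E3BranchBSkewUnitSign
open Summit.HodgeConjecture.HodgeConjecture.R90.S1
open Summit.HodgeConjecture.HodgeConjecture.R90.S1.BposRamShellFibres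
open Summit.HodgeConjecture.HodgeConjecture.R90.S1.BposRamShellFibresOdd
open Summit.HodgeConjecture.HodgeConjecture.R90.S1.BposRamGaussSphereCovariance

variable (L : Type) [Field L] [NumberField L] [IsCMField L] (v : HeightOneSpectrum (𝓞 ↥(maximalRealSubfield L)))
  (w : PlacesOver L v) (hw : IsCMField.complexConj L • w.1 = w.1)

variable [MeasurableSpace (LocalRing L v)] [BorelSpace (LocalRing L v)]
  (μY : Measure ↥(HeisRing.skewPart (conjLocal L (IsCMField.complexConj L) v))) [μY.IsAddHaarMeasure] [μY.Regular]
  (χ₁ : (LocalRing L v)ˣ →* ℂˣ)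
  (hB : ∀ u : (LocalRing L v)ˣ, (∀ w' : PlacesOver L v, Valued.v ((u : LocalRing L v) w') = 1) →
    χ₁ (u * Units.map (conjLocal L (IsCMField.complexConj L) v : LocalRing L v →* LocalRing L v) u) = 1)

/-! ## §1 `Φ` is invariant under multiplication by norms of units of absolute value one -/

open scoped Classical in
include hw hB in
/-- **`Φ(N(y)·a) = Φ(a)`** for every unit `y` of `R` with `|y_{w′}| = 1` at every `w′` and EVERY `a ∈ R`, `N(y) := y·σy`: the unit `e := y·σy` is `σ`-fixed with `|e_w| = 1`, so
★ p864588 gives `Φ(e·a) = χ₁(e)⁻¹·Φ(a)`, and `χ₁(y·σy) = 1` is the Branch-B hypothesis `hB`. [cite: Keys1984, §7 Theorem (2) (d) p. 126] [cite: WeilBNT1967, Ch. II §5] -/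
theorem setIntegral_sphere_diteInv_sub_norm_mul (y : (LocalRing L v)ˣ) (hy : ∀ w' : PlacesOver L v, Valued.v ((y : LocalRing L v) w') = 1) (a : LocalRing L v) :
    ∫ s in {s : ↥(HeisRing.skewPart (conjLocal L (IsCMField.complexConj L) v)) | Valued.v ((s : LocalRing L v) w) = WithZero.exp (-1 : ℤ)},
        (fun r : LocalRing L v => if h : IsUnit r then (((χ₁ h.unit)⁻¹ : ℂˣ) : ℂ) else 0)
          ((((y * Units.map (conjLocal L (IsCMField.complexConj L) v : LocalRing L v →* LocalRing L v) y : (LocalRing L v)ˣ)) : LocalRing L v) * a -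
            (s : LocalRing L v)) ∂μY =
      ∫ s in {s : ↥(HeisRing.skewPart (conjLocal L (IsCMField.complexConj L) v)) | Valued.v ((s : LocalRing L v) w) = WithZero.exp (-1 : ℤ)},
        (fun r : LocalRing L v => if h : IsUnit r then (((χ₁ h.unit)⁻¹ : ℂˣ) : ℂ) else 0) (a - (s : LocalRing L v)) ∂μY := by
  have hσ := conjLocal_conjLocal_cm L v
  have heσ : conjLocal L (IsCMField.complexConj L) v
      ((((y * Units.map (conjLocal L (IsCMField.complexConj L) v : LocalRing L v →* LocalRing L v) y : (LocalRing L v)ˣ)) : LocalRing L v)) =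
        (((y * Units.map (conjLocal L (IsCMField.complexConj L) v : LocalRing L v →* LocalRing L v) y : (LocalRing L v)ˣ)) : LocalRing L v) := by
    rw [Units.val_mul, Units.coe_map, MonoidHom.coe_coe, map_mul, hσ, mul_comm]
  have hev : Valued.v (((((y * Units.map (conjLocal L (IsCMField.complexConj L) v : LocalRing L v →* LocalRing L v) y : (LocalRing L v)ˣ)) : LocalRing L v)) w) = 1 := by
    rw [Units.val_mul, Units.coe_map, MonoidHom.coe_coe, Pi.mul_apply, map_mul, valued_conjLocal_apply_of_smul_eq L v w hw, hy w, mul_one]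
  rw [setIntegral_sphere_diteInv_units_mul_sub L v w hw μY χ₁ _ heσ hev a, hB y hy, inv_one, Units.val_one, one_mul]

/-! ## §2 Constancy of `Φ` along the base family `a′(t, x) = lᵗ·(−(x·σx)·c)`, `l = σΠ̂·Π̂`, on each level -/

omit [MeasurableSpace (LocalRing L v)] [BorelSpace (LocalRing L v)] in
/-- Bookkeeping: `lᵗ·(−(x·σx)·c) = −N(piU^t·x̂)·c` for `l = Units.map σ piU * piU` and a unit `x = x̂` (`N(W) := W·σW` in `Rˣ`). [cite: Rogawski1990, §12.2 (2) p. 173] -/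
theorem family_eq_neg_norm_mul (piU : (LocalRing L v)ˣ) (c : LocalRing L v) (t : ℕ) (X : (LocalRing L v)ˣ) :
    ((((Units.map (conjLocal L (IsCMField.complexConj L) v : LocalRing L v →* LocalRing L v) piU * piU) ^ t : (LocalRing L v)ˣ)) : LocalRing L v) *
        (-((X : LocalRing L v) * conjLocal L (IsCMField.complexConj L) v (X : LocalRing L v)) * c) =
      -((((piU ^ t * X) * Units.map (conjLocal L (IsCMField.complexConj L) v : LocalRing L v →* LocalRing L v) (piU ^ t * X) : (LocalRing L v)ˣ)) :
          LocalRing L v) * c := by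
  simp only [Units.val_mul, Units.val_pow_eq_pow_val, Units.coe_map, MonoidHom.coe_coe, map_mul, map_pow]
  ring

include hw hB in
open scoped Classical in
/-- **NORM-CLASS CONSTANCY ALONG THE BASE FAMILY.**  For `l := Units.map σ piU * piU` (`piU ∈ Rˣ` arbitrary), any `c ∈ R`, and two members
`a′ᵢ := l^{tᵢ}·(−(xᵢ·σxᵢ)·c)` (`i = 1, 2`) of EQUAL NON-ZERO LEVEL `|a′₁|_w = |a′₂|_w ≠ 0`: **`Φ(a′₁) = Φ(a′₂)`**.  Indeed `a′₁ = N(y)·a′₂` with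
`y := (piU^t₁·x̂₁)·(piU^t₂·x̂₂)⁻¹ ∈ Rˣ`, and `|N(y)|_w = 1` forces `|y|_w = 1` (`|σy|_w = |y|_w`), so §1 applies (`hB`).  This is the (G1)-as-letter input of the critical-level
letter `hΦcrit : ∀ t x, |a′_w| = |ϖ|^(m+1) → Φ(a′) = Φcrit` of p07 (6e) ∕ p03 (6d-R): no parity or conductor hypothesis is involved. [cite: Keys1984, §7 Theorem (2) (d) p. 126]
[cite: Rogawski1990, §12.2 (2) p. 173] -/
theorem setIntegral_sphere_diteInv_sub_family_eq (piU : (LocalRing L v)ˣ) (c : LocalRing L v) (t₁ t₂ : ℕ) (x₁ x₂ : LocalRing L v)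
    (hlev : Valued.v ((((((Units.map (conjLocal L (IsCMField.complexConj L) v : LocalRing L v →* LocalRing L v) piU * piU) ^ t₁ : (LocalRing L v)ˣ)) : LocalRing L v) *
        (-(x₁ * conjLocal L (IsCMField.complexConj L) v x₁) * c)) w) =
      Valued.v ((((((Units.map (conjLocal L (IsCMField.complexConj L) v : LocalRing L v →* LocalRing L v) piU * piU) ^ t₂ : (LocalRing L v)ˣ)) : LocalRing L v) *
        (-(x₂ * conjLocal L (IsCMField.complexConj L) v x₂) * c)) w))
    (hne : Valued.v ((((((Units.map (conjLocal L (IsCMField.complexConj L) v : LocalRing L v →* LocalRing L v) piU * piU) ^ t₁ : (LocalRing L v)ˣ)) : LocalRing L v) *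
        (-(x₁ * conjLocal L (IsCMField.complexConj L) v x₁) * c)) w) ≠ 0) :
    ∫ s in {s : ↥(HeisRing.skewPart (conjLocal L (IsCMField.complexConj L) v)) | Valued.v ((s : LocalRing L v) w) = WithZero.exp (-1 : ℤ)},
        (fun r : LocalRing L v => if h : IsUnit r then (((χ₁ h.unit)⁻¹ : ℂˣ) : ℂ) else 0)
          (((((Units.map (conjLocal L (IsCMField.complexConj L) v : LocalRing L v →* LocalRing L v) piU * piU) ^ t₁ : (LocalRing L v)ˣ)) : LocalRing L v) *
              (-(x₁ * conjLocal L (IsCMField.complexConj L) v x₁) * c) - (s : LocalRing L v)) ∂μY =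
      ∫ s in {s : ↥(HeisRing.skewPart (conjLocal L (IsCMField.complexConj L) v)) | Valued.v ((s : LocalRing L v) w) = WithZero.exp (-1 : ℤ)},
        (fun r : LocalRing L v => if h : IsUnit r then (((χ₁ h.unit)⁻¹ : ℂˣ) : ℂ) else 0)
          (((((Units.map (conjLocal L (IsCMField.complexConj L) v : LocalRing L v →* LocalRing L v) piU * piU) ^ t₂ : (LocalRing L v)ˣ)) : LocalRing L v) *
              (-(x₂ * conjLocal L (IsCMField.complexConj L) v x₂) * c) - (s : LocalRing L v)) ∂μY := by
  set σ' : LocalRing L v →* LocalRing L v := (conjLocal L (IsCMField.complexConj L) v : LocalRing L v →* LocalRing L v) with hσ'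
  have hσ'c : ∀ r : LocalRing L v, σ' r = conjLocal L (IsCMField.complexConj L) v r := fun r => rfl
  have hval := valued_conjLocal_apply_of_smul_eq L v w hw
  -- the two levels, read through `|lᵗ·(−(x·σx)·c)|_w = |lᵗ|_w·|x|_w²·|c|_w`
  have hlevel : ∀ (t : ℕ) (x : LocalRing L v),
      Valued.v ((((((Units.map σ' piU * piU) ^ t : (LocalRing L v)ˣ)) : LocalRing L v) * (-(x * conjLocal L (IsCMField.complexConj L) v x) * c)) w) =
        Valued.v (((((Units.map σ' piU * piU) ^ t : (LocalRing L v)ˣ)) : LocalRing L v) w) * (Valued.v (x w) * Valued.v (x w)) * Valued.v (c w) := by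
    intro t x
    rw [Pi.mul_apply, map_mul, Pi.mul_apply, map_mul, Pi.neg_apply, Valuation.map_neg, Pi.mul_apply, map_mul, hval]
    simp only [mul_assoc]
  -- `x₁`, `x₂` are units
  have hx₁0 : x₁ w ≠ 0 := by
    intro h
    apply hne
    rw [hlevel, h, map_zero, mul_zero, mul_zero, zero_mul]
  have hne₂ : Valued.v ((((((Units.map σ' piU * piU) ^ t₂ : (LocalRing L v)ˣ)) : LocalRing L v) * (-(x₂ * conjLocal L (IsCMField.complexConj L) v x₂) * c)) w) ≠ 0 := by
    rw [← hlev]; exact hne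
  have hx₂0 : x₂ w ≠ 0 := by
    intro h
    apply hne₂
    rw [hlevel, h, map_zero, mul_zero, mul_zero, zero_mul]
  have hX₁ := K2E3DepthZeroIwahoriCharacterCM.isUnit_of_apply_ne_zero L v w hw x₁ hx₁0
  have hX₂ := K2E3DepthZeroIwahoriCharacterCM.isUnit_of_apply_ne_zero L v w hw x₂ hx₂0
  -- the two norms `Wᵢ·σWᵢ`, `Wᵢ := piU^tᵢ·x̂ᵢ`
  set W₁ : (LocalRing L v)ˣ := piU ^ t₁ * hX₁.unit with hW₁
  set W₂ : (LocalRing L v)ˣ := piU ^ t₂ * hX₂.unit with hW₂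
  have ha₁ : ((((Units.map σ' piU * piU) ^ t₁ : (LocalRing L v)ˣ)) : LocalRing L v) * (-(x₁ * conjLocal L (IsCMField.complexConj L) v x₁) * c) =
      -(((W₁ * Units.map σ' W₁ : (LocalRing L v)ˣ)) : LocalRing L v) * c := by
    have h := family_eq_neg_norm_mul L v piU c t₁ hX₁.unit
    rw [IsUnit.unit_spec] at h
    rw [hW₁]; exact h
  have ha₂ : ((((Units.map σ' piU * piU) ^ t₂ : (LocalRing L v)ˣ)) : LocalRing L v) * (-(x₂ * conjLocal L (IsCMField.complexConj L) v x₂) * c) =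
      -(((W₂ * Units.map σ' W₂ : (LocalRing L v)ˣ)) : LocalRing L v) * c := by
    have h := family_eq_neg_norm_mul L v piU c t₂ hX₂.unit
    rw [IsUnit.unit_spec] at h
    rw [hW₂]; exact h
  -- the quotient `y := W₁·W₂⁻¹` and `a′₁ = N(y)·a′₂`
  set y : (LocalRing L v)ˣ := W₁ * W₂⁻¹ with hy
  have hNy : y * Units.map σ' y * (W₂ * Units.map σ' W₂) = W₁ * Units.map σ' W₁ := by
    rw [hy, map_mul, map_inv, mul_mul_mul_comm W₁ W₂⁻¹ (Units.map σ' W₁) (Units.map σ' W₂)⁻¹, mul_assoc,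
      mul_mul_mul_comm W₂⁻¹ (Units.map σ' W₂)⁻¹ W₂ (Units.map σ' W₂), inv_mul_cancel, inv_mul_cancel, mul_one, mul_one]
  have hquot : (((y * Units.map σ' y : (LocalRing L v)ˣ)) : LocalRing L v) *
      (((((Units.map σ' piU * piU) ^ t₂ : (LocalRing L v)ˣ)) : LocalRing L v) * (-(x₂ * conjLocal L (IsCMField.complexConj L) v x₂) * c)) =
      ((((Units.map σ' piU * piU) ^ t₁ : (LocalRing L v)ˣ)) : LocalRing L v) * (-(x₁ * conjLocal L (IsCMField.complexConj L) v x₁) * c) := by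
    rw [ha₁, ha₂, ← hNy, Units.val_mul (y * Units.map σ' y)]
    ring
  -- `|N(y)|_w = 1`, hence `|y|_{w′} = 1`
  have hc0 : Valued.v (c w) ≠ 0 := by
    intro h; apply hne; rw [hlevel, h, mul_zero]
  have hNv : Valued.v ((((y * Units.map σ' y : (LocalRing L v)ˣ)) : LocalRing L v) w) = 1 := by
    have h : Valued.v (((((y * Units.map σ' y : (LocalRing L v)ˣ)) : LocalRing L v) *
        (((((Units.map σ' piU * piU) ^ t₂ : (LocalRing L v)ˣ)) : LocalRing L v) * (-(x₂ * conjLocal L (IsCMField.complexConj L) v x₂) * c))) w) =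
        Valued.v ((((((Units.map σ' piU * piU) ^ t₁ : (LocalRing L v)ˣ)) : LocalRing L v) * (-(x₁ * conjLocal L (IsCMField.complexConj L) v x₁) * c)) w) := by
      rw [hquot]
    rw [Pi.mul_apply, map_mul, hlev] at h
    exact (mul_eq_right₀ hne₂).1 h
  have hyv : Valued.v ((y : LocalRing L v) w) = 1 := by
    have h2 : Valued.v ((y : LocalRing L v) w) ^ 2 = 1 := by
      rw [Units.val_mul, Pi.mul_apply, map_mul, Units.coe_map, MonoidHom.coe_coe, hval] at hNv
      rw [sq]; exact hNv
    exact le_antisymm ((pow_le_one_iff two_ne_zero).1 h2.le) ((one_le_pow_iff two_ne_zero).1 h2.ge)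
  have hy' : ∀ w' : PlacesOver L v, Valued.v ((y : LocalRing L v) w') = 1 := forall_placesOver_of_apply L v w hw hyv
  rw [← hquot]
  exact setIntegral_sphere_diteInv_sub_norm_mul L v w hw μY χ₁ hB y hy' _

end Summit.HodgeConjecture.HodgeConjecture.R90.S1.BposRamGaussSphereFamily

end
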